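import Mathlib
import HarnessLib
import HarnessLib.Audit
import Summits.CriticalPhenomena.Statement
import Literature.Probability.Percolation.DislocationLoopCover
import Summits.CriticalPhenomena.PercolationContinuityZ3.Theorems.PercDislocationCoversCoverMonotone
import Summits.CriticalPhenomena.PercolationContinuityZ3.Theorems.PercDislocationCoversAssembly

/-!
Route: PercLoopDislocationCovers

DORMANT since 2026-08-30T13:56:26Z (reconciler: no traction for 5 d (last activity statement-closed at 2026-08-25T13:12:03Z); parked, not closed — `ledger route dormant route-CriticalPhenomena-PercLoopDislocationCovers --off` to reactiv) — unstaffed, not closed; items shared with open routes are served there. `ledger route dormant <id> --off` reactivates.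

# Route PercLoopDislocationCovers — lift to loop-dislocated covers of Z^3 — continuity = cover slope
s^(5/6) vs subcritical shift (nu' < 6/5), both below p_c

It suffices to show X = C1 ∧ C2a [card
CriticalPhenomena/PercolationContinuityZ3/dislocation-covers-monotone-lift, re-engineered]:
for the EXPLICIT family G_s := Literature.Probability.Percolation.dislocationLoopCover s (s ≥ 2) of
covering graphs of ℤ³ (the landed Literature object: Biggs's covering graph Γ̃(W, φ) of ℤ³,
Biggs1974 Def 19.1, for W = ∗_{ℤ³} ℤ/2 realised on reduced words; rev 4/7: the three cover items are
stated BY NAME over it since the inlined `fromRel` term of rev ≤ 3 was refuted as a covering — see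
KILL CRITERIA (i); its root component ℤ³ × {reduced words} is the reduced-word cover of the interim
rev-5 filing) — vertex set ℤ³ × (words in letters ℤ³), root component ℤ³ × {reduced words}
(`reachable_root_iff`), sheets exchanged by a
ℤ/2-holonomy when a bond crosses one of a periodic array (period s) of square "dislocation-loop"
patches of y-bonds of side ⌊s/2⌋,
independent letters per patch (deck group = free product of ℤ/2's: nonamenable, exponential growth
exp(Θ(1/s)), quasi-transitive,
balls of radius < s/2 around the base point õ = (0, []) are ℤ³-balls) —
 (C1) CoverSlopeBound: θ_{G_s}(õ, p) ≤ C s^{5/6} (p − p_c(G_s, õ))₊ for all p ≤ p_c(ℤ³) (a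
mean-field slope bound for the cover
 ACROSS ITS OWN critical point, constant polynomial in the dislocation spacing, only in the regime
where the base is subcritical or critical);
 (C2a) Z3SubcritLengthExponent: a finite-size form of ξ(p_c − ε) ≤ C ε^{−ν'} on ℤ³ with SOME ν' <
6/5.
With the provable support items (covering monotonicity θ_{ℤ³}(0,p) ≤ θ_{G_s}(õ,p) pointwise in p;
Prod.fst is a covering map;
CoverSubcritTransfer: G_s is subcritical whenever the ℤ³ finite-size criterion holds at a scale L
with C₀ L log L ≤ s) one gets
p_c(G_s) ≥ p_c(ℤ³) − ε_s with ε_s ≈ (s/log s)^{−1/ν'}, hence θ(p_c) ≤ θ_{G_s}(õ, p_c) ≤ C s^{5/6}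
ε_s → 0 because 5/6 < 1/ν'.
Lean: `(∃ C : ℝ, ∀ s : ℕ, 2 ≤ s → ∀ p : unitInterval, (p : ℝ) ≤
Literature.Probability.Percolation.criticalProb (Literature.Probability.LatticeModels.zdGraph 3) 0 →
Literature.Probability.Percolation.theta (Literature.Probability.Percolation.dislocationLoopCover s)
((0 : Literature.Probability.LatticeModels.Site 3), ([] : List (ℤ × ℤ × ℤ))) p ≤ C * (s : ℝ) ^ ((5 :
ℝ) / 6) * max 0 ((p : ℝ) - Literature.Probability.Percolation.criticalProb
(Literature.Probability.Percolation.dislocationLoopCover s) ((0 :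
Literature.Probability.LatticeModels.Site 3), ([] : List (ℤ × ℤ × ℤ))))) ∧ (∃ ν C : ℝ, ν < 6 / 5 ∧ ∀
p : unitInterval, (p : ℝ) < Literature.Probability.Percolation.criticalProb
(Literature.Probability.LatticeModels.zdGraph 3) 0 → ∀ L : ℕ, C *
(Literature.Probability.Percolation.criticalProb (Literature.Probability.LatticeModels.zdGraph 3) 0
- p) ^ (-ν) ≤ L → ((2 * L + 1) ^ 3 : ℝ) * (Literature.Probability.Percolation.bondPercolation
(Literature.Probability.LatticeModels.zdGraph 3) p).real
(Literature.Probability.Percolation.siteToBoundary 3 L) ≤ 1 / 2)`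

## Assembly
Elementary real analysis + the definition of `criticalProb` (planner Sketch.lean rc 0; `Assembly`
unfolds by `rfl` to `… → theta (zdGraph 3) 0 (criticalProbI 3) = 0`).
Fix the constants ν' < 6/5, C₁ of Z3SubcritLengthExponent and C₀ of CoverSubcritTransfer. For s
large put L_s := ⌊s / (C₀ (log₂ s + 1))⌋ ≥ 1
(then C₀ L_s (log₂ L_s + 1) ≤ s) and ε_s := (C₁ / L_s)^{1/ν'} (case ν' > 0, C₁ > 0; if ν' ≤ 0 or C₁
≤ 0 the criterion holds for all
p < p_c at a fixed scale and the argument only simplifies). For p ≤ p_c − ε_s: C₁ (p_c − p)^{−ν'} ≤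
L_s, so the criterion holds at
(L_s, p) and CoverSubcritTransfer gives θ_{G_s}(õ, p) = 0; hence p_c(G_s, õ) ≥ p_c − ε_s
(criticalProb is an sInf over {p | θ > 0} ∪ {1}).
CoverSlopeBound at p = criticalProbI 3 gives θ_{G_s}(õ, p_c) ≤ C s^{5/6} ε_s ≤ C' s^{5/6 − 1/ν'}
(log s)^{1/ν'} → 0 since 1/ν' > 5/6.
CoverIsCoveringR (covering map, = `DislocationLoopCover.bijOn_fst_neighborSet`) feeds CoverMonotone
with φ = Prod.fst, φ õ = 0: θ_{ℤ³}(0, p_c) ≤ θ_{G_s}(õ, p_c) for every s ≥ 2; so θ(p_c) ≤ 0 ≤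
θ(p_c).
No unproved named Literature fact is used anywhere in the route (Hutchcroft2016's theorem is implied
by CoverSlopeBound at p = p_c(G_s), not assumed; `dislocationLoopCover` is a Literature DEFINITION
with proved API, not a fact).

Rationale: WHY THIS LINE. Deform the GRAPH, not the measure, in the one direction that comes with a free
inequality: for a (weak) covering map φ : G → ℤ³,
θ_{ℤ³}(φ x, p) ≤ θ_G(x, p) for every p (Campanino 1985; BenjaminiSchramm1996 Thm 1; LyonsPeres2016
Thm 6.47, verified pp. 316–317 of the held
copy), so θ(p_c) ≤ inf_s θ_{G_s}(õ, p_c(ℤ³)). The approximants are chosen SOLVABLE from the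
hyperbolic side: finite-order dislocation
LOOPS make every lifted core finite, so outside the cores G_s is a disjoint union of copies of a
strictly subcritical ℤ³-subgraph
(p_c(ℤ³ minus patches) > p_c(ℤ³), AizenmanGrimmett1991) glued in the pattern of the Bass–Serre tree
of a free product of ℤ/2's —
percolation on such tree-graded graphs is a Galton–Watson process over the pieces (Kozáková
arXiv:math/0611668, Špakulová arXiv:0801.4153),
mean-field across p_c(G_s), and Hutchcroft2016 / arXiv:2002.02916 / arXiv:2207.00701 is the general
nonamenable theory behind C1.
Imported areas: covering-space / geometric group theory (free products, tree-graded structure,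
nonamenability), branching processes,
nonamenable percolation; the ℤ³ input is purely SUBCRITICAL (ν' < 6/5 and, inside C1, a Newman-type
'jump ⇒ ν ≥ 6/5' inequality) —
unlike the nine existing routes of this conjunct, which all posit hypotheticals AT or ABOVE p_c(ℤ³).
Negatives index: nothing related.

RANKED CRUXES. #2 CoverSlopeBound (crux) — (card crux C1, restricted to p ≤ p_c(ℤ³) so that it does
not silently contain β ≥ 1/6 above p_c) there is C such that for every s ≥ 2 and every p ≤ p_c(ℤ³):
θ_{G_s}(õ, p) ≤ C · s^{5/6} · max(0, p − p_c(G_s, õ)), G_s =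
Literature.Probability.Percolation.dislocationLoopCover s the NAMED loop-dislocated cover (rev 4;
root component ℤ³ × W, `reachable_root_iff`), õ = (0, []). At p < p_c(G_s) trivial; at p = p_c(G_s)
it is Hutchcroft's θ_{G_s}(p_c(G_s)) = 0; on (p_c(G_s), p_c(ℤ³)] it is a linear (β_cover ≥ 1) bound
with constant s^{5/6}; scaling prediction for the true constant: s^{(1−β)/ν} ≈ s^{0.66}, binding at
p = p_c(ℤ³). [difficulty: open-problem] (why it might fail: Binding point p = p_c(Z^3): there it
reads pi_{p_c}(s) <~ s^(5/6) Delta_s, a Newman-type 'jump => nu >= 6/5' inequality no present tool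
gives; theta <= C*Delta across p_c(G) on nonamenable G is known only when p_c < p_(2->2), open at
Cheeger ~ 1/s; the free-product/Galton-Watson regime controls theta_{G_s} only while xi(p) <~ s/log
s, and L^2/triangle constants on G_s scale like s^2 or worse.) [arXiv:2002.02916, arXiv:2207.00701,
arXiv:1904.05804, arXiv:math/0611668, arXiv:0801.4153, Hutchcroft2016, BenjaminiSchramm1996,
LyonsPeres2016, Newman1986, zbl:0948.60098]
#3 Z3SubcritLengthExponent (crux) — (card crux C2, ℤ³ part, least usable exponent) there are ν' <
6/5 and C such that for every p < p_c(ℤ³) and every L ≥ C (p_c − p)^{−ν'} the finite-size criterion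
(2L+1)³ · P_p(0 ↔ ∂B(L)) ≤ 1/2 holds (event `siteToBoundary 3 L`, the one of `perc_sharpness`); i.e.
the subcritical correlation length of bond percolation on ℤ³ obeys ξ(p_c − ε) log ξ ≲ ε^{−ν'} with
ν' < 6/5 (numerics: ν ≈ 0.876). Pure ℤ³, subcritical, shareable with other routes (cf.
PercDebrisSweep's SubcritChiBelowCube, PercTwoPointDecay r2). [difficulty: open-problem] (why it
might fail: No polynomial bound on the subcritical correlation length of Z^3 is known at all (best:
xi(p_c - eps) <= exp(C/eps^2), DuminilcopinKozmaTassion2020); a first proof would likely give a huge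
exponent, while the race needs nu' < 6/5 (truth nu ~ 0.88; a jump world may have nu = infinity).)
[DuminilcopinKozmaTassion2020, DuminilCopinTassionCMP2016, Grimmett1999, AizenmanNewman1984,
Hutchcroft2020]
#9 CoverSubcritTransfer (support) — (card crux C2, cover part — made provable by FINITE cores) there
is C₀ such that for all s ≥ 2, L ≥ 1 with C₀ L (log₂ L + 1) ≤ s and all p < p_c(ℤ³) satisfying the
criterion (2L+1)³ P_p(0 ↔ ∂B(L)) ≤ 1/2, the cover does not percolate: θ_{G_s}(õ, p) = 0. Proof plan
(~1.5k lines): (i) Hammersley/Simon–Lieb iteration via bk_inequality_holds: P_p(0 ↔ ∂B(kL)) ≤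
2^{1−k}, so τ_p(y,z) ≤ 2·2^{−|y−z|_∞/L}; (ii) cover geometry from the Literature API: bonds off the
patches keep the word (`dislocationLoopCover_adj_of_bondLetter_eq_none`), so G_s minus the lifted
patch cores is a disjoint union of copies of F_s = ℤ³ minus patch bonds ⊆ ℤ³ indexed by the words,
the root component glued along the TREE 'sheet w — sheet act P w through the patch-P bonds' (Cayley
graph of W = ∗ ℤ/2; `reachable_root_iff`, `adj_patchCorner_cons`); each patch is finite
(`finite_patchBase_label`, ⌊s/2⌋² bonds) and each lifted core (one patch, one pair of sheets {w, act
P w}) has ≤ 4⌊s/2⌋² ≤ s² vertices — TRUE for the named cover, false for the refuted rev ≤ 3 term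
(infinite sheet towers, refuter notes on stmt-6530); (iii) core-to-core bridging number m ≤ C s⁴
2^{−s/(2L)} < 1 once s ≥ C₀ L log L (patches are ≥ s/2 apart); (iv) BK over chains of distinct
lifted cores ⇒ E[#cores in C(õ)] < ∞ ⇒ with a.s.-finite F-clusters
(theta_eq_zero_of_lt_criticalProb_holds + subgraph monotonicity) C(õ) is a.s. finite. [difficulty:
L] [Grimmett1999, LyonsPeres2016, Literature.Probability.Percolation.bk_inequality_holds,
Literature.Probability.Percolation.perc_sharpness_holds]
#9 CoverMonotone (support) — covering monotonicity (Campanino 1985; BenjaminiSchramm1996 Thm 1;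
LyonsPeres2016 Thm 6.47, pp. 316–317 of the held copy): if φ : V → W maps the G-neighbourhood of
every vertex ONTO the H-neighbourhood of its image (weak covering, vertex form), then θ_H(φ v, p) ≤
θ_G(v, p) for all v, p. Proof = LP's exploration coupling: explore C(φ v) in H edge by edge, lift
each newly examined edge to a fresh G-edge at the current lifted endpoint (exists by SurjOn;
distinct H-edges lift to distinct G-edges), copy its state; an infinite H-cluster lifts to an
infinite open tree at v. Countable V, W for measurability. [difficulty: provable-now]
[LyonsPeres2016, BenjaminiSchramm1996, doi:10.1214/ecp.v1-978]
#9 CoverIsCoveringR (support) — covering canary for the NAMED cover (rev-4 repair): for every s ≥ 2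
and every vertex v of G_s = dislocationLoopCover s, Prod.fst restricted to the G_s-neighbours of v
is a bijection onto the ℤ³-neighbours of v.1 (so Prod.fst is a covering map and CoverMonotone
applies with φ = Prod.fst, φ õ = 0); one line from `DislocationLoopCover.bijOn_fst_neighborSet` (the
generators act by `act` = head-toggle on reduced words, identity on non-reduced ones: an involution
on all lists). Its predecessor CoverIsCovering (stmt-CriticalPhenomena-6532), stated for the inlined
`fromRel` term acting by the RAW head-toggle on all lists, was REFUTED
(PercLoopDislocationCoversCoverIsCovering_refuted @ 754796b272e2; s = 2: [P,P] ↦ [P] and [] ↦ [P]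
give ((1,2,0),[P]) two lifts of one base edge) and stays in the file as a settled negative record.
(A second repair seat, rfix-b95fe50a, filed at rev 5 the same canary for an inlined SUBTYPE form {w
// List.IsChain (· ≠ ·) w} as LoopCoverIsCovering, kernel-certified in its folder Cert.lean; rev 7
converged the route on the named Literature cover — same root component — and dropped
LoopCoverIsCovering as subsumed by the Literature theorem.) [difficulty: provable-now] [Biggs1974,
LyonsPeres2016, BenjaminiSchramm1996]

TWO-LAYER PLAN. CoverSlopeBound ⇐ FreeProductMeanField → NewmanTypeSlope → CoverSlopeBound (k = 2,
depth 1): FreeProductMeanField = for p ≤ p_c(ℤ³),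
θ_{G_s}(õ,p) ≤ C s^A · P_p(0 ↔ ∂B(s/4)) · (m_s(p) − 1)₊-type Galton–Watson bound over the tree of
lifted cores (pieces F_s strictly
subcritical on [0, p_c(ℤ³)] by AizenmanGrimmett1991; Kozáková/Špakulová generating-function
calculus; left-continuity of θ_{G_s} above
p_c(G_s) by Häggström–Peres–Schonmann merging, zbl:0948.60098); NewmanTypeSlope = the residual ℤ³
inequality at the binding point,
π_{p_c}(s) ≤ C s^{5/6} · (p_c − ξ^{−1}(s/ log s)) ('a jump forces ν ≥ 6/5').
Z3SubcritLengthExponent: no split foreseen (a proof would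
come with its own ladder). CoverSubcritTransfer ⇐ CriterionIteration → CoreBridgingSubunit →
CoverSubcritTransfer if a prover asks.

KILL CRITERIA. (i) ¬CoverIsCovering (the construction is not a covering of ℤ³) or infinite lifted
cores: every cover item must be restated with a
corrected family (route edit --restate ×3) — not a kill of the line, but of this filing — FIRED
2026-08-15 (¬CoverIsCovering, s = 2 witness) and REPAIRED (rev 4, converged rev 7 after a two-seat
race through a subtype re-inlining at rev 5): CoverIsCovering → CoverIsCoveringR, CoverSlopeBound
and CoverSubcritTransfer restated 1:1 over Literature.Probability.Percolation.dislocationLoopCover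
(covering property now PROVED in Literature, so a residual construction defect could only surface as
¬CoverSubcritTransfer → restate or close); (ii) a proof, numerical certificate or heuristic
consensus that the shift p_c(ℤ³) − p_c(G_s) decays no faster than s^{−5/6} (equivalently ξ(p_c − ε)
≳ ε^{−6/5} at the scales probed)
refutes CoverSlopeBound ∧ Z3SubcritLengthExponent jointly → close refuted:CoverSlopeBound; (iii)
Z3SubcritLengthExponent refuted
(ν ≥ 6/5 rigorously) → close; (iv) a theorem that slightly supercritical θ on EVERY quasi-transitive
cover of ℤ³ inherits the base
one-arm factor only at scale ξ (i.e. that C1's constant is ≥ s^{1/ν'} for any provable ν') collapses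
the race to a tie → close as
exhausted; (v) moot if π_{p_c}(n) → 0 is proved directly (PercTwoPointDecay X_A,
PercLowPointHalfSpace) — then θ(p_c) = 0 outright.

NOT DECOMPOSED YET. The Galton–Watson/free-product structure of G_s (offspring law of a lifted core,
its variance, Russo bounds on dm/dp), the
left-continuity input (HPS merging on quasi-transitive G_s), the Cheeger constant h(G_s) ≍ 1/s and
the universal form of C1
('θ_G(p_c(G)+Δ) ≤ C(deg) h(G)^{−5/6} Δ for nonamenable quasi-transitive G' — not excluded by any
ℤ^d-based example since
sup_d (1−β_d)/ν_d ≈ 0.66 < 5/6), the quasi-transitivity / exponential-growth / unimodularity checks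
of G_s (not needed by the
Assembly), and every constant in CoverSubcritTransfer. Prior programme: not consulted (plancard
mode).

CHEAPEST FALSIFIER. (1) Lean, hours: settle CoverIsCovering for s = 2, 3, 4 by case analysis — RUN
by refuters (rreview-88c4c9eb, refute-pool-g41): FALSE for the inlined term, repaired at rev 4/7
(CoverIsCoveringR is a one-liner from the Literature API; rfix's Cert.lean also kernel-checks the s
= 2 examples 'crossing the patch bond (1,1,0)→(1,2,0) toggles [] ↔ [P]' and 'over ((1,2,0),[P]) the
only lift of (1,1,0) is ((1,1,0),[])' for the equivalent subtype form); the cheapest remaining Lean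
check is CoverMonotone (LP Thm 6.47 exploration coupling, provable-now) and, for the construction,
quasi-transitivity of the root component from `deck`/`shift`. (2) kit Monte Carlo, ~1 cpu-day: bond
percolation on the double cover of an N³ torus branched along ONE square loop of side N/4 (two
sheets, rewired y-bonds through the
patch): wrapping probabilities at p = 0.2488 must agree with the plain torus within error (p_c
unchanged by a finite-order dislocation
loop; a measurable shift kills CoverSubcritTransfer's premise that cores are inert) and, on G_s
truncated to sheets of word-length ≤ 3,
the onset of sheet-to-sheet percolation must sit at ξ(p) ≈ s/(2 log s), i.e. shift exponent ≈ 1/ν ≈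
1.14 > 5/6. (3) Literature: a
quantitative Martineau–Severo bound p_c(ℤ³) − p_c(G) ≥ f(tameness radius) with f(s) ≫ s^{−5/6} would
kill the race; their proof
(arXiv:1803.09686, Thm 2.1 / Cor 2.3) gives an exponentially small f, consistent. None of (1)–(3)
could be run this session (hub compute-free; kit not in payload).

NUMBERS. p_c^bond(ℤ³) ≈ 0.24881; ν ≈ 0.876, β ≈ 0.418, β/ν ≈ 0.477 (one-arm), (1−β)/ν ≈ 0.664
(predicted true slope exponent of C1),
1/ν ≈ 1.141 (predicted shift exponent); thresholds filed: slope 5/6 ≈ 0.833 (margin 0.17), ν' < 6/5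
(margin 0.32), race
s^{5/6 − 1/ν'} → 0. Rigorous: ξ(p_c − ε) ≤ exp(C ε^{−2}) (DuminilcopinKozmaTassion2020, d ≥ 3); jump
⇒ γ ≥ 2 (Newman1986 /
AizenmanNewman1984-type), hence with χ ≤ C (ξ log ξ)³ only ν_jump ≥ 2/3 classically — C1 upgrades
this to 6/5 via the cover.
Cover data: gr(G_s) = exp(Θ(1/s)); flat radius of õ ≈ s/2; patches side ⌊s/2⌋, spacing s (gaps ≥
s/2); lifted core ≤ 2·2·(s/2)² vertices;
predicted p_c(G_s) at ξ(p) ≈ s/(2 log s). Items at open: 6 (2 cruxes, 3 support, 1 assembly); rev 7: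
six active items — 2 cruxes (CoverSlopeBound r2, Z3SubcritLengthExponent r3), 3 support
(CoverSubcritTransfer, CoverMonotone, CoverIsCoveringR), 1 assembly — plus the refuted
CoverIsCovering and the retired rev-5 subtype filing (LoopCoverIsCovering dropped) kept as records.

DEFINITION REQUESTS. `dislocationLoopCover (s : ℕ) : SimpleGraph (Site 3 × List (ℤ × ℤ × ℤ))` under
Summits/CriticalPhenomena/PercolationContinuityZ3/Theorems
— LANDED as Literature.Probability.Percolation.dislocationLoopCover
(Literature/Probability/Percolation/DislocationLoopCover.lean: Biggs1974 Def 19.1 covering graph for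
W = ∗_{ℤ³} ℤ/2 on reduced words, faithful to the inlined term on the root component and a genuine
cover everywhere; API bijOn_fst_neighborSet, reachable_root_iff, deck, shift,
finite_patchBase_label) and USED BY NAME by the three cover items (rev 4, re-asserted rev 7; a
different carrier, e.g. the reduced-word subtype of the rev-5 filing, should be proposed as a change
to the Literature definition — the items follow by name — never re-inlined); and,
optionally, `IsWeakCovering φ G H := ∀ v, Set.SurjOn φ (G.neighborSet v) (H.neighborSet (φ v))`
under Literature/Probability/Percolation
(LyonsPeres2016 §6.9). Filed with `ledger workitem add --kind definition` right after open. No cite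
facts wanted: the Assembly uses none.

Novelty: Searches (2026-08-15, this session): lit frontier CriticalPhenomena --since 2020 (30 rows, none on
covers/quotients); lit bridges
CriticalPhenomena --cross any (30 rows, none); zbMATH: 'percolation covering graph critical
probability' (10; MartineauSevero2019 =
arXiv:1803.09686 the only relevant), 'locality critical probability percolation transitive graphs'
(8: arXiv:1808.08940, arXiv:2310.10983,
arXiv:2205.10253, MartineauTassion2017, arXiv:1410.2453), 'slightly supercritical percolation
nonamenable' (1: arXiv:2207.00701),
'upper bounds percolation correlation length' (arXiv:1902.03207), 'critical percolation free product
of groups' (arXiv:math/0611668),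
'critical percolation virtually free groups tree-like graphs' (arXiv:0801.4153), 'Haggstrom Peres
Schonmann relentless merging'
(zbl:0948.60098); 'Ising/percolation screw dislocation', 'percolation lattice defect line
dislocation threshold', 'branched covering cone
angle lattice', 'infinite sheeted Riemann surface lattice' (0 relevant each; crossref returns only
metallurgy); lit read LyonsPeres2016
pp. 316–317 (Thm 6.47 and proof quoted); held Haggstrom2011 survey grep 'cover' (nothing); local
searchd down (connection reset),
arXiv/OpenAlex/S2 HTTP 429, galaxy --star all queued > 90 s (recorded). Plus the card's and the
novelty audit's searches (LP 6.47, BS96,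
M–S Cor 2.3, Hutchcroft 1605.05301, zbMATH ×4, galaxy pdf).
Nearest prior art found: BenjaminiSchramm1996 Thm 1 / LyonsPeres2016 Thm 6.47 (θ_base ≤ θ_cover
pointwise  [refs: 1803.09686, 1808.08940, 2310.10983, 2205.10253, 1410.2453, 2207.00701, 1902.03207, math/0611668, 0801.4153, 2002.02916, MartineauSevero2019, MartineauTassion2017, LyonsPeres2016, Haggstrom2011, BenjaminiSchramm1996, Hutchcroft2016]

Barriers (technique_class: covering-lift, hyperbolic-approximant, monotone-comparison): - technique_class: covering-lift, hyperbolic-approximant, monotone-comparison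
- Literature.Barriers.CriticalPhenomena.SubexponentialGrowthZd: evaded in form — nothing of the
growth/susceptibility method is applied to ℤ³ (gr = 1); G_s has gr = exp(Θ(1/s)) > 1 and ℤ³ enters
only through θ_{ℤ³} ≤ θ_{G_s}; Hutchcroft2016 is not even a logical input (CoverSlopeBound at p =
p_c(G_s) contains it). Not evaded in substance: the degeneration of every nonamenable constant as s
→ ∞ IS crux CoverSlopeBound (asked: ≤ s^{5/6}); the bet is stated, not hidden.
- Literature.Barriers.CriticalPhenomena.AmenableInvariantPercolation: not engaged on ℤ³ — no
invariant-percolation density threshold is invoked on the amenable lattice; mass-transport/BLPS-type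
tools would act on G_s (Cheeger ≍ 1/s > 0), with the s-dependence again inside CoverSlopeBound. Same
for AmenableInvariantPercolationZd / …Bond / …Profile and BLPSCriticalReduction.
- Literature.Barriers.CriticalPhenomena.SlabLimitUniformControl: the structural twin from the other
side (slabs ↑ ℤ³ need a uniform modulus, DST Prop. 3). It does not evade the need for uniform
control; the bet is that approaching from the hyperbolic side (covers ↓ ℤ³, comparison inequality
free and pointing the right way, no exhaustion identity) the control needed is SUBcritical — ν' <
6/5 plus a Newman-type slope inequality — instead of an RSW/critical input, and it is filed as two
refutable exponent bounds.
- Literature.Barriers.CriticalPhenomena.SprinklingRenormal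

History (route lifecycle, newest last):
- 2026-08-15T20:34:05Z · rev 4: restated CoverIsCovering (stmt-CriticalPhenomena-6532 refuted), CoverSlopeBound (stmt-CriticalPhenomena-6528), CoverSubcritTransfer (stmt-CriticalPhenomena-6530), Assembly (stmt-CriticalPhenomena-6533) — repair: CoverIsCovering (stmt-CriticalPhenomena-6532) refuted-misstated by Summit.CriticalPhenomena.Percolati (planner-rrefute-CriticalPhenomena-PercLoopDisl-39c777da-0)
- 2026-08-15T20:34:05Z · REPAIRED (restate CoverIsCovering, CoverSlopeBound, CoverSubcritTransfer, Assembly) — back to open: repair: CoverIsCovering (stmt-CriticalPhenomena-6532) refuted-misstated by Summit.CriticalPhenomena.PercolationContinuityZ3.Theorems.PercLoopDislocationCoversCo (planner-rrefute-CriticalPhenomena-PercLoopDisl-39c777da-0)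
- 2026-08-15T20:35:57Z · rev 5: restated CoverSlopeBound (stmt-CriticalPhenomena-13890), CoverSubcritTransfer (stmt-CriticalPhenomena-13891), Assembly (stmt-CriticalPhenomena-13892) — repair (rfix-b95fe50a): CoverIsCovering (stmt-6532) refuted by PercLoopDislocationCoversCoverIsCovering_refuted — the rev<=3 filing typed G_s on ALL words (non- (planner-rfix-CriticalPhenomena-PercLoopDislo-b95fe50a-0)
- 2026-08-15T20:41:02Z · rev 7: restated CoverSlopeBound (stmt-CriticalPhenomena-13912), CoverSubcritTransfer (stmt-CriticalPhenomena-13913), Assembly (stmt-CriticalPhenomena-13914) — CONVERGENCE EDIT after a repair race (two repair units were spawned for this route): rev 4 (this seat, rrefute-39c777da, 20:34:05Z) restated the three cover ite (planner-rrefute-CriticalPhenomena-PercLoopDisl-39c777da-0)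
- 2026-08-15T20:41:02Z · rev 7: dropped LoopCoverIsCovering — CONVERGENCE EDIT after a repair race (two repair units were spawned for this route): rev 4 (this seat, rrefute-39c777da, 20:34:05Z) restated the three cover ite (planner-rrefute-CriticalPhenomena-PercLoopDisl-39c777da-0)
- 2026-08-22T12:14:33Z · DORMANT — reconciler: no traction for 5.3 d (last activity item-evidence-added at 2026-08-17T04:00:08Z); parked, not closed — `ledger route dormant route-CriticalPhenomen (operator:999:805893)
- 2026-08-23T15:02:22Z · REACTIVATED — reconciler: reactivated — activity item-proof-filed at 2026-08-23T13:14:32Z after parking at 2026-08-22T12:14:33Z (operator:999:2220014)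
- 2026-08-30T13:56:26Z · DORMANT — reconciler: no traction for 5 d (last activity statement-closed at 2026-08-25T13:12:03Z); parked, not closed — `ledger route dormant route-CriticalPhenomena-Per (operator:999:2429209)

sub-problem: PercolationContinuityZ3 · status: dormant · opened planner-plancard-CriticalPhenomena-Percolatio-f4bba8ba-0 2026-08-15T12:11:14Z · rev 7 · ledger route-CriticalPhenomena-PercLoopDislocationCovers
GENERATED by the gate from the ledger (D-0016/17). Provers cite these decls: `theorem foo : Summit.CriticalPhenomena.PercolationContinuityZ3.Theses.PercLoopDislocationCovers.<Decl> := …` in Summits/CriticalPhenomena/PercolationContinuityZ3/Theorems/<Name>.lean.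
-/

namespace Summit.CriticalPhenomena.PercolationContinuityZ3.Theses.PercLoopDislocationCovers

open scoped BigOperators Topology Manifold Classical MeasureTheory ProbabilityTheory Matrix InnerProductSpace ComplexConjugate ContinuousMap
open Filter Set Function TopologicalSpace MeasureTheory

attribute [summit_statement] _root_.PercolationContinuityZ3

-- earlier CoverSlopeBound (stmt-CriticalPhenomena-13890, replaced 2026-08-15T20:35:57Z -> stmt-CriticalPhenomena-13912): retired by None — ∃ C : ℝ, ∀ s : ℕ, 2 ≤ s → ∀ p : unitInterval, (p : ℝ) ≤ Literature.Probability.Percolation.criticalProb (Literature.Probability.LatticeModels.zdGraph 3) 0 → Literature.Probability.Percolation.theta (Literature.Probability.Percolation.dislocationLoopCover s) ((0 :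
-- earlier CoverSlopeBound (stmt-CriticalPhenomena-13912, replaced 2026-08-15T20:41:02Z -> stmt-CriticalPhenomena-13951): retired by None — (fun G : ℕ → SimpleGraph (Literature.Probability.LatticeModels.Site 3 × {w : List (ℤ × ℤ × ℤ) // List.IsChain (· ≠ ·) w}) => ∃ C : ℝ, ∀ s : ℕ, 2 ≤ s → ∀ p : unitInterval, (p : ℝ) ≤ Literature.Probability.Percolation.criticalProb (Literature.Probability.LatticeMod
-- earlier CoverSlopeBound (stmt-CriticalPhenomena-6528, replaced 2026-08-15T20:34:05Z -> stmt-CriticalPhenomena-13890): open — (fun G : ℕ → SimpleGraph (Literature.Probability.LatticeModels.Site 3 × List (ℤ × ℤ × ℤ)) => ∃ C : ℝ, ∀ s : ℕ, 2 ≤ s → ∀ p : unitInterval, (p : ℝ) ≤ Literature.Probability.Percolation.criticalProb (Literature.Probability.LatticeModels.zdGraph 3) 0 → Literature.Probability.Pe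
/-- item stmt-CriticalPhenomena-13951 · crux · rank 2 · open · by planner
why it might fail: Binding point p = p_c(Z^3): needs a Newman-type 'jump => nu >= 6/5' inequality no present tool gives; theta <= C*Delta across p_c(G) on nonamenable G is known only if p_c < p_(2->2) (open at Cheeger ~ 1/s); C(s) ~ nabla_{p_c}(G_s) must stay <~ s^(5/6) as G_s -> Z^3, where nabla = oo.
sources: arXiv:2002.02916, arXiv:2207.00701, arXiv:1904.05804, arXiv:math/0611668, arXiv:0801.4153, Hutchcroft2016
[crux] CoverSlopeBound over the NAMED cover (same decl name; rev 4, re-asserted rev 7 after the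
rev-5 race) — the same inequality for the NAMED cover G_s =
Literature.Probability.Percolation.dislocationLoopCover s (component of õ = (0, []) = ℤ³ × {reduced
words} = ℤ³ × W, W = ∗_{ℤ³} ℤ/2, by `reachable_root_iff`; deck transformations `deck`, lifted
translations `shift` ⇒ quasi-transitive root component; Cheeger ≍ 1/s): there is C such that for
every s ≥ 2 and every p ≤ p_c(ℤ³): θ_{G_s}(õ, p) ≤ C · s^{5/6} · max(0, p − p_c(G_s, õ)). At p <
p_c(G_s) trivial; at p = p_c(G_s) it is θ_{G_s}(p_c(G_s)) = 0 (Hutchcroft2016-type, root component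
nonamenable of exponential growth); on (p_c(G_s), p_c(ℤ³)] a linear (β_cover ≥ 1) bound with
constant s^{5/6}; scaling prediction for the true constant s^{(1−β)/ν} ≈ s^{0.66}, binding at p =
p_c(ℤ³). [difficulty: open-problem] -/
@[route_item "route-CriticalPhenomena-PercLoopDislocationCovers"]
def CoverSlopeBound : Prop :=
  ∃ C : ℝ, ∀ s : ℕ, 2 ≤ s → ∀ p : unitInterval, (p : ℝ) ≤ Literature.Probability.Percolation.criticalProb (Literature.Probability.LatticeModels.zdGraph 3) 0 → Literature.Probability.Percolation.theta (Literature.Probability.Percolation.dislocationLoopCover s) ((0 : Literature.Probability.LatticeModels.Site 3), ([] : List (ℤ × ℤ × ℤ))) p ≤ C * (s : ℝ) ^ ((5 : ℝ) / 6) * max 0 ((p : ℝ) - Literature.Probability.Percolation.criticalProb (Literature.Probability.Percolation.dislocationLoopCover s) ((0 : Literature.Probability.LatticeModels.Site 3), ([] : List (ℤ × ℤ × ℤ))))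

/-- item stmt-CriticalPhenomena-6529 · crux · rank 3 · open · by planner
why it might fail: No polynomial bound on the Z³ correlation length is known: best ξ_p≤exp(C|p−p_c|^{-2}) (DuminilcopinKozmaTassion2020 Thm 2); a first polynomial proof is unlikely to land below 6/5 (truth ν≈0.87; rigorous floor only ν≥2/3, ibid. §8); if θ jumps, L(p) may grow faster than any power.
sources: DuminilcopinKozmaTassion2020, arXiv:1902.03207, DuminilCopinTassionCMP2016, AizenmanNewman1984, Hutchcroft2020, Grimmett1999
[crux] (card crux C2, ℤ³ part, least usable exponent) there are ν' < 6/5 and C such that for every p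
< p_c(ℤ³) and every L ≥ C (p_c − p)^{−ν'} the finite-size criterion (2L+1)³ · P_p(0 ↔ ∂B(L)) ≤ 1/2
holds (event `siteToBoundary 3 L`, the one of `perc_sharpness`); i.e. the subcritical correlation
length of bond percolation on ℤ³ obeys ξ(p_c − ε) log ξ ≲ ε^{−ν'} with ν' < 6/5 (numerics: ν ≈
0.876). Pure ℤ³, subcritical, shareable with other routes (cf. PercDebrisSweep's
SubcritChiBelowCube, PercTwoPointDecay r2). [difficulty: open-problem] -/
@[route_item "route-CriticalPhenomena-PercLoopDislocationCovers"]
def Z3SubcritLengthExponent : Prop :=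
  ∃ ν C : ℝ, ν < 6 / 5 ∧ ∀ p : unitInterval, (p : ℝ) < Literature.Probability.Percolation.criticalProb (Literature.Probability.LatticeModels.zdGraph 3) 0 → ∀ L : ℕ, C * (Literature.Probability.Percolation.criticalProb (Literature.Probability.LatticeModels.zdGraph 3) 0 - p) ^ (-ν) ≤ L → ((2 * L + 1) ^ 3 : ℝ) * (Literature.Probability.Percolation.bondPercolation (Literature.Probability.LatticeModels.zdGraph 3) p).real (Literature.Probability.Percolation.siteToBoundary 3 L) ≤ 1 / 2

/-- item stmt-CriticalPhenomena-13889 · support · rank 9 · closed · proved by Summit.CriticalPhenomena.PercolationContinuityZ3.Theorems.PercLoopDislocationCoversCoverIsCoveringR.coverIsCoveringR_proof @ 4e72ed05b746 (prover) · by planner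
sources: Biggs1974, LyonsPeres2016, BenjaminiSchramm1996, Literature.Probability.Percolation.DislocationLoopCover.bijOn_fst_neighborSet
[support] repaired CoverIsCovering (refuted as typed for the mis-built inlined graph): for every s ≥
2 and every vertex v of the NAMED cover G_s =
Literature.Probability.Percolation.dislocationLoopCover s, Prod.fst restricted to the G_s-neighbours
of v is a bijection onto the ℤ³-neighbours of v.1 (covering map; feeds CoverMonotone with φ =
Prod.fst, φ õ = 0, õ = (0, [])). What changed: the generators act by `DislocationLoopCover.act` =
head-toggle on REDUCED words and the identity on non-reduced ones — an involution on all lists —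
instead of the raw head-toggle, under which [P,P] ↦ [P] and [] ↦ [P] gave (u+e₁,[P]) two lifts of
one base edge (the refuters' witness, s = 2). One line from the Literature API:
`DislocationLoopCover.bijOn_fst_neighborSet s v` (planner Sketch.lean rc 0). [difficulty:
provable-now] [sources: Biggs1974 Def 19.1; LyonsPeres2016 §6.9; BenjaminiSchramm1996 Thm 1] -/
@[route_item "route-CriticalPhenomena-PercLoopDislocationCovers"]
def CoverIsCoveringR : Prop :=
  ∀ s : ℕ, 2 ≤ s → ∀ v : Literature.Probability.LatticeModels.Site 3 × List (ℤ × ℤ × ℤ), Set.BijOn Prod.fst ((Literature.Probability.Percolation.dislocationLoopCover s).neighborSet v) ((Literature.Probability.LatticeModels.zdGraph 3).neighborSet v.1)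

-- `CoverIsCoveringR` holds: proved by `Summit.CriticalPhenomena.PercolationContinuityZ3.Theorems.PercLoopDislocationCoversCoverIsCoveringR.coverIsCoveringR_proof` @ 4e72ed05b746 (its module imports this route file, so no `_holds` link can be stated here).

-- earlier CoverSubcritTransfer (stmt-CriticalPhenomena-13891, replaced 2026-08-15T20:35:57Z -> stmt-CriticalPhenomena-13913): retired by None — ∃ C₀ : ℕ, ∀ (s L : ℕ) (p : unitInterval), 2 ≤ s → 1 ≤ L → C₀ * L * (Nat.log 2 L + 1) ≤ s → (p : ℝ) < Literature.Probability.Percolation.criticalProb (Literature.Probability.LatticeModels.zdGraph 3) 0 → ((2 * L + 1) ^ 3 : ℝ) * (Literature.Probability.Percolat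
-- earlier CoverSubcritTransfer (stmt-CriticalPhenomena-13913, replaced 2026-08-15T20:41:02Z -> stmt-CriticalPhenomena-13952): retired by None — (fun G : ℕ → SimpleGraph (Literature.Probability.LatticeModels.Site 3 × {w : List (ℤ × ℤ × ℤ) // List.IsChain (· ≠ ·) w}) => ∃ C₀ : ℕ, ∀ (s L : ℕ) (p : unitInterval), 2 ≤ s → 1 ≤ L → C₀ * L * (Nat.log 2 L + 1) ≤ s → (p : ℝ) < Literature.Probability.Percolati
-- earlier CoverSubcritTransfer (stmt-CriticalPhenomena-6530, replaced 2026-08-15T20:34:05Z -> stmt-CriticalPhenomena-13891): proved by Summit.CriticalPhenomena.PercolationContinuityZ3.Theorems.CoverSubcritTransfer.coverSubcritTransfer_proof @ cea0df021a0f — (fun G : ℕ → SimpleGraph (Literature.Probability.LatticeModels.Site 3 × List (ℤ × ℤ × ℤ)) => ∃ C₀ : ℕ, ∀ (s L : ℕ) (p : unitInterval), 2 ≤ s → 1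
/-- item stmt-CriticalPhenomena-13952 · support · rank 9 · closed · proved by Summit.CriticalPhenomena.PercolationContinuityZ3.Theorems.CoverSubcritTransfer.coverSubcritTransfer_proof @ cea0df021a0f (prover) · by planner
sources: Grimmett1999, LyonsPeres2016, Biggs1974, Literature.Probability.Percolation.bk_inequality_holds, Literature.Probability.Percolation.perc_sharpness_holds
[support] CoverSubcritTransfer for the NAMED cover G_s =
Literature.Probability.Percolation.dislocationLoopCover s (same decl name; rev 4, re-asserted rev
7): there is C₀ such that for all s ≥ 2, L ≥ 1 with C₀ L (log₂ L + 1) ≤ s and all p < p_c(ℤ³)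
satisfying the finite-size criterion (2L+1)³ P_p(0 ↔ ∂B(L)) ≤ 1/2, the cover does not percolate:
θ_{G_s}(õ, p) = 0. Proof plan (~1.5k lines): (i) Hammersley/Simon–Lieb iteration via
bk_inequality_holds: P_p(0 ↔ ∂B(kL)) ≤ 2^{1−k}, so τ_p(y,z) ≤ 2·2^{−|y−z|_∞/L}; (ii) cover geometry
FROM THE LITERATURE API: bonds off the patches keep the word
(`dislocationLoopCover_adj_of_bondLetter_eq_none`), so G_s minus the lifted patch cores is a
disjoint union of copies of F_s = ℤ³ minus patch bonds ⊆ ℤ³ indexed by the words, the root component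
glued along the TREE 'sheet w — sheet act P w through the patch-P bonds' (Cayley graph of W = ∗ ℤ/2,
`reachable_root_iff`, `adj_patchCorner_cons`); each patch is finite (`finite_patchBase_label`,
⌊s/2⌋² bonds) and each lifted core (one patch, one pair of sheets {w, act P w}) has ≤ 4⌊s/2⌋² ≤ s²
vertices; (iii) core-to-core bridging number m ≤ C s⁴ 2^{−s/(2L)} < 1 once s ≥ C₀ L log L (patches ≥
s/2 apart, `patchC -/
@[route_item "route-CriticalPhenomena-PercLoopDislocationCovers"]
def CoverSubcritTransfer : Prop :=
  ∃ C₀ : ℕ, ∀ (s L : ℕ) (p : unitInterval), 2 ≤ s → 1 ≤ L → C₀ * L * (Nat.log 2 L + 1) ≤ s → (p : ℝ) < Literature.Probability.Percolation.criticalProb (Literature.Probability.LatticeModels.zdGraph 3) 0 → ((2 * L + 1) ^ 3 : ℝ) * (Literature.Probability.Percolation.bondPercolation (Literature.Probability.LatticeModels.zdGraph 3) p).real (Literature.Probability.Percolation.siteToBoundary 3 L) ≤ 1 / 2 → Literature.Probability.Percolation.theta (Literature.Probability.Percolation.dislocationLoopCover s) ((0 : Literature.Probability.LatticeModels.Site 3),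 ([] : List (ℤ × ℤ × ℤ))) p = 0

-- `CoverSubcritTransfer` holds: proved by `Summit.CriticalPhenomena.PercolationContinuityZ3.Theorems.CoverSubcritTransfer.coverSubcritTransfer_proof` @ cea0df021a0f (its module imports this route file, so no `_holds` link can be stated here).

/-- item stmt-CriticalPhenomena-6531 · support · rank 9 · closed · proved by Summit.CriticalPhenomena.PercolationContinuityZ3.Theorems.PercDislocationCoversCoverMonotone.coverMonotone_proof @ 4e72ed05b746 (prover) · by planner
sources: LyonsPeres2016, BenjaminiSchramm1996, doi:10.1214/ecp.v1-978
[support] covering monotonicity (Campanino 1985; BenjaminiSchramm1996 Thm 1; LyonsPeres2016 Thm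
6.47, pp. 316–317 of the held copy): if φ : V → W maps the G-neighbourhood of every vertex ONTO the
H-neighbourhood of its image (weak covering, vertex form), then θ_H(φ v, p) ≤ θ_G(v, p) for all v,
p. Proof = LP's exploration coupling: explore C(φ v) in H edge by edge, lift each newly examined
edge to a fresh G-edge at the current lifted endpoint (exists by SurjOn; distinct H-edges lift to
distinct G-edges), copy its state; an infinite H-cluster lifts to an infinite open tree at v.
Countable V, W for measurability. [difficulty: provable-now] -/
@[route_item "route-CriticalPhenomena-PercLoopDislocationCovers"]
def CoverMonotone : Prop :=
  ∀ {V W : Type} [Countable V] [Countable W] (G : SimpleGraph V) (H : SimpleGraph W) (φ : V → W), (∀ v : V, Set.SurjOn φ (G.neighborSet v) (H.neighborSet (φ v))) → ∀ (v : V) (p : unitInterval), Literature.Probability.Percolation.theta H (φ v) p ≤ Literature.Probability.Percolation.theta G v p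

/-- `CoverMonotone` holds: proved by `Summit.CriticalPhenomena.PercolationContinuityZ3.Theorems.PercDislocationCoversCoverMonotone.coverMonotone_proof` @ 4e72ed05b746. -/
theorem CoverMonotone_holds : CoverMonotone := _root_.Summit.CriticalPhenomena.PercolationContinuityZ3.Theorems.PercDislocationCoversCoverMonotone.coverMonotone_proof

-- earlier Assembly (stmt-CriticalPhenomena-13892, replaced 2026-08-15T20:35:57Z -> stmt-CriticalPhenomena-13914): retired by None — CoverMonotone → CoverIsCoveringR → CoverSubcritTransfer → Z3SubcritLengthExponent → CoverSlopeBound → PercolationContinuityZ3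
-- earlier Assembly (stmt-CriticalPhenomena-13914, replaced 2026-08-15T20:41:02Z -> stmt-CriticalPhenomena-13953): retired by None — CoverMonotone → LoopCoverIsCovering → CoverSubcritTransfer → Z3SubcritLengthExponent → CoverSlopeBound → PercolationContinuityZ3
-- earlier Assembly (stmt-CriticalPhenomena-6533, replaced 2026-08-15T20:34:05Z -> stmt-CriticalPhenomena-13892): proved by Summit.CriticalPhenomena.PercolationContinuityZ3.Theorems.PercDislocationCoversAssembly.assembly_proof @ 33706488ffa0 — CoverMonotone → CoverIsCovering → CoverSubcritTransfer → Z3SubcritLengthExponent → CoverSlopeBound → PercolationContinuityZ3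
/-- item stmt-CriticalPhenomena-13953 · assembly · rank 1 · closed · proved by Summit.CriticalPhenomena.PercolationContinuityZ3.Theorems.PercLoopDislocationCoversAssembly.assembly_proof @ f5fa9107e126 (prover) · by planner
sources: LyonsPeres2016, Grimmett1999
[assembly] CoverMonotone → CoverIsCoveringR → CoverSubcritTransfer → Z3SubcritLengthExponent →
CoverSlopeBound → PercolationContinuityZ3 (the root-level conjunct abbrev of
Summits/CriticalPhenomena/PercolationContinuityZ3/Statement.lean); the deciding theorem `closes` has
exactly these hypotheses (rev 7 convergence on the named Literature cover). -/
@[route_item "route-CriticalPhenomena-PercLoopDislocationCovers"]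
def Assembly : Prop :=
  CoverMonotone → CoverIsCoveringR → CoverSubcritTransfer → Z3SubcritLengthExponent → CoverSlopeBound → PercolationContinuityZ3

-- `Assembly` holds: proved by `Summit.CriticalPhenomena.PercolationContinuityZ3.Theorems.PercLoopDislocationCoversAssembly.assembly_proof` @ f5fa9107e126 (its module imports this route file, so no `_holds` link can be stated here).

-- records of items no longer active in this route (dropped / restated):
-- earlier CoverIsCovering (stmt-CriticalPhenomena-6532, replaced 2026-08-15T20:34:05Z -> stmt-CriticalPhenomena-13889): refuted by Summit.CriticalPhenomena.PercolationContinuityZ3.Theorems.PercLoopDislocationCoversCoverIsCovering_refuted @ 13777f7e9932 — (fun G : ℕ → SimpleGraph (Literature.Probability.LatticeModels.Site 3 × List (ℤ × ℤ × ℤ)) => ∀ s : ℕ, 2 ≤ s → ∀ v : Literature.Probability.LatticeM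

/-! D-0027 §2.1 — DECIDING THEOREM (planner-authored via `route open/edit --closes-file`; by planner-rrefute-CriticalPhenomena-PercLoopDisl-39c777da-0 2026-08-15T20:41:02Z):
its hypotheses are this route's items and its conclusion the sub-problem Statement (glue_lint), and it elaborates with this file. -/

@[closes "route-CriticalPhenomena-PercLoopDislocationCovers"] theorem closes : CoverMonotone → CoverIsCoveringR → CoverSubcritTransfer → Z3SubcritLengthExponent → CoverSlopeBound → _root_.PercolationContinuityZ3 := by
  intro hMono hCov hTransfer hLen hSlope
  -- θ_{ℤ³}(p_c) = 0 from the five items by elementary real analysis (no Literature fact): with L = 2^k,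
  -- s = C₀'2^k(k+1), ε = (C₁'/2^k)^{1/ν'}, CoverSubcritTransfer + Z3SubcritLengthExponent give θ_{G_s}(õ,·) = 0
  -- below p_c - ε, so p_c(G_s,õ) ≥ p_c - ε (criticalProb is an infimum); CoverSlopeBound at p = p_c then gives
  -- θ_{G_s}(õ,p_c) ≤ C's^{5/6}ε ≤ K(k+1)r^k, r = 2^{5/6-1/ν'} < 1 as ν' < 6/5, which → 0; and
  -- θ_{ℤ³}(0,p_c) ≤ θ_{G_s}(õ,p_c) by CoverMonotone along Prod.fst, a covering map of the NAMED cover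
  -- G_s = Literature.Probability.Percolation.dislocationLoopCover s by CoverIsCoveringR.
  have key : ∀ (Θ : ℕ → unitInterval → ℝ) (Pc : ℕ → ℝ) (crit : ℕ → unitInterval → Prop)
      (pcI : unitInterval) (θc : ℝ),
      (∀ s : ℕ, 2 ≤ s → θc ≤ Θ s pcI) →
      (∀ (s : ℕ) (x : ℝ), x ≤ 1 → (∀ q : unitInterval, 0 < Θ s q → x ≤ (q : ℝ)) → x ≤ Pc s) →
      (∃ C₀ : ℕ, ∀ (s L : ℕ) (p : unitInterval), 2 ≤ s → 1 ≤ L → C₀ * L * (Nat.log 2 L + 1) ≤ s →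
          (p : ℝ) < pcI → crit L p → Θ s p = 0) →
      (∃ ν C : ℝ, ν < 6 / 5 ∧ ∀ p : unitInterval, (p : ℝ) < pcI → ∀ L : ℕ,
          C * ((pcI : ℝ) - p) ^ (-ν) ≤ L → crit L p) →
      (∃ C : ℝ, ∀ s : ℕ, 2 ≤ s → ∀ p : unitInterval, (p : ℝ) ≤ pcI →
          Θ s p ≤ C * (s : ℝ) ^ ((5 : ℝ) / 6) * max 0 ((p : ℝ) - Pc s)) →
      θc ≤ 0 := by
    intro Θ Pc crit pcI θc hcmp hPc hT hΛ hS
    obtain ⟨C₀, hC₀⟩ := hT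
    obtain ⟨ν, C₁, hν, hC₁⟩ := hΛ
    obtain ⟨C, hC⟩ := hS
    have hpc1 : (pcI : ℝ) ≤ 1 := unitInterval.le_one pcI
    obtain ⟨C₀', hC₀'1, hT'⟩ : ∃ C₀' : ℕ, 1 ≤ C₀' ∧ ∀ (s L : ℕ) (p : unitInterval), 2 ≤ s → 1 ≤ L →
        C₀' * L * (Nat.log 2 L + 1) ≤ s → (p : ℝ) < pcI → crit L p → Θ s p = 0 := by
      refine ⟨max C₀ 1, le_max_right _ _, fun s L p hs hL hsL hp hcrit => hC₀ s L p hs hL (le_trans ?_ hsL) hp hcrit⟩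
      exact Nat.mul_le_mul (Nat.mul_le_mul (le_max_left _ _) le_rfl) le_rfl
    obtain ⟨ν', C₁', hν'1, hν'lt, hC₁'1, hΛ'⟩ : ∃ ν' C₁' : ℝ, 1 ≤ ν' ∧ ν' < 6 / 5 ∧ 1 ≤ C₁' ∧
        ∀ p : unitInterval, (p : ℝ) < pcI → ∀ L : ℕ, C₁' * ((pcI : ℝ) - p) ^ (-ν') ≤ L → crit L p := by
      refine ⟨max ν 1, max C₁ 1, le_max_right _ _, max_lt hν (by norm_num), le_max_right _ _, ?_⟩
      intro p hp L hL
      refine hC₁ p hp L (le_trans ?_ hL)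
      have hx0 : 0 < (pcI : ℝ) - p := sub_pos.2 hp
      have hx1 : (pcI : ℝ) - p ≤ 1 := by linarith [unitInterval.nonneg p]
      calc C₁ * ((pcI : ℝ) - p) ^ (-ν) ≤ max C₁ 1 * ((pcI : ℝ) - p) ^ (-ν) :=
            mul_le_mul_of_nonneg_right (le_max_left _ _) (Real.rpow_nonneg hx0.le _)
        _ ≤ max C₁ 1 * ((pcI : ℝ) - p) ^ (-max ν 1) := by
            apply mul_le_mul_of_nonneg_left _ (le_trans zero_le_one (le_max_right _ _))
            exact Real.rpow_le_rpow_of_exponent_ge hx0 hx1 (neg_le_neg (le_max_left _ _))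
    obtain ⟨C', hC'1, hS'⟩ : ∃ C' : ℝ, 1 ≤ C' ∧ ∀ s : ℕ, 2 ≤ s →
        Θ s pcI ≤ C' * (s : ℝ) ^ ((5 : ℝ) / 6) * max 0 ((pcI : ℝ) - Pc s) := by
      refine ⟨max C 1, le_max_right _ _, fun s hs => ?_⟩
      calc Θ s pcI ≤ C * (s : ℝ) ^ ((5 : ℝ) / 6) * max 0 ((pcI : ℝ) - Pc s) := hC s hs pcI le_rfl
        _ ≤ max C 1 * (s : ℝ) ^ ((5 : ℝ) / 6) * max 0 ((pcI : ℝ) - Pc s) := by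
            rw [mul_assoc, mul_assoc]
            exact mul_le_mul_of_nonneg_right (le_max_left _ _)
              (mul_nonneg (Real.rpow_nonneg (Nat.cast_nonneg _) _) (le_max_left _ _))
    have hlow : ∀ (s L : ℕ) (ε : ℝ), 2 ≤ s → 1 ≤ L → C₀' * L * (Nat.log 2 L + 1) ≤ s → 0 < ε →
        C₁' * ε ^ (-ν') ≤ L → (pcI : ℝ) - ε ≤ Pc s := by
      intro s L ε hs hL hsL hε hεL
      refine hPc s _ (by linarith) ?_
      intro q hθq
      by_contra hlt
      have hlt' : (q : ℝ) < (pcI : ℝ) - ε := not_le.1 hlt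
      have hqpc : (q : ℝ) < pcI := by linarith
      have hgap : ε ≤ (pcI : ℝ) - q := by linarith
      have hcrit : crit L q := hΛ' q hqpc L (le_trans (by
        apply mul_le_mul_of_nonneg_left _ (le_trans zero_le_one hC₁'1)
        exact Real.rpow_le_rpow_of_nonpos hε hgap (by linarith)) hεL)
      have h0 := hT' s L q hs hL hsL hqpc hcrit
      linarith
    have hν'pos : 0 < ν' := by linarith
    have hC'pos : 0 < C' := by linarith
    have hC₁'pos : 0 < C₁' := by linarith
    have hC₁'ne : C₁' ≠ 0 := hC₁'pos.ne'
    have hC₀'pos : (0 : ℝ) < C₀' := by exact_mod_cast hC₀'1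
    obtain ⟨e, he_gt, he_le, he_def⟩ : ∃ e : ℝ, (5 : ℝ) / 6 < e ∧ e ≤ 1 ∧ e * ν' = 1 := by
      refine ⟨1 / ν', ?_, ?_, by field_simp⟩
      · have h65 : (5 : ℝ) / 6 = 1 / (6 / 5) := by norm_num
        rw [h65]
        exact one_div_lt_one_div_of_lt hν'pos hν'lt
      · simpa using one_div_le_one_div_of_le one_pos hν'1
    have he_pos : 0 < e := by linarith
    obtain ⟨r, hr_pos, hr_lt, hr_def⟩ : ∃ r : ℝ, 0 < r ∧ r < 1 ∧ r = (2 : ℝ) ^ ((5 : ℝ) / 6 - e) :=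
      ⟨_, Real.rpow_pos_of_pos (by norm_num) _, Real.rpow_lt_one_of_one_lt_of_neg (by norm_num) (by linarith), rfl⟩
    have hrne : r ≠ 0 := hr_pos.ne'
    have h1 := tendsto_self_mul_const_pow_of_lt_one hr_pos.le hr_lt
    have h2 : Filter.Tendsto (fun k : ℕ => ((k : ℝ) + 1) * r ^ (k + 1)) Filter.atTop (nhds 0) := by
      have h := h1.comp (Filter.tendsto_add_atTop_nat 1)
      simpa only [Function.comp_def, Nat.cast_add, Nat.cast_one] using h
    have hlim : Filter.Tendsto (fun k : ℕ => C' * C₀' * C₁' ^ e / r * (((k : ℝ) + 1) * r ^ (k + 1)))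
        Filter.atTop (nhds 0) := by
      simpa only [mul_zero] using h2.const_mul (C' * C₀' * C₁' ^ e / r)
    apply le_of_forall_pos_le_add
    intro δ hδ
    rw [zero_add]
    obtain ⟨k, hk, hk1⟩ := ((hlim.eventually (Iio_mem_nhds hδ)).and (Filter.eventually_ge_atTop 1)).exists
    have hk' : C' * C₀' * C₁' ^ e / r * (((k : ℝ) + 1) * r ^ (k + 1)) < δ := hk
    have h2k : 1 ≤ 2 ^ k := Nat.one_le_two_pow
    have hs2 : 2 ≤ C₀' * 2 ^ k * (k + 1) := by
      have h4 : 2 ^ 1 ≤ 2 ^ k := Nat.pow_le_pow_right (by norm_num) hk1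
      calc 2 = 1 * 2 ^ 1 * 1 := by norm_num
        _ ≤ C₀' * 2 ^ k * (k + 1) := Nat.mul_le_mul (Nat.mul_le_mul hC₀'1 h4) (by omega)
    have hsL : C₀' * 2 ^ k * (Nat.log 2 (2 ^ k) + 1) ≤ C₀' * 2 ^ k * (k + 1) := by
      rw [Nat.log_pow (by norm_num : 1 < 2)]
    have ha_pos : (0 : ℝ) < (2 : ℝ) ^ k := pow_pos (by norm_num) k
    have hε_pos : 0 < (C₁' / (2 : ℝ) ^ k) ^ e := Real.rpow_pos_of_pos (div_pos hC₁'pos ha_pos) _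
    have hεL : C₁' * ((C₁' / (2 : ℝ) ^ k) ^ e) ^ (-ν') ≤ ((2 ^ k : ℕ) : ℝ) := by
      have hexp : e * -ν' = -1 := by rw [mul_neg, he_def]
      rw [← Real.rpow_mul (div_pos hC₁'pos ha_pos).le, hexp, Real.rpow_neg_one, inv_div]
      have hcancel : C₁' * ((2 : ℝ) ^ k / C₁') = (2 : ℝ) ^ k := by field_simp
      rw [hcancel]
      exact_mod_cast le_rfl
    have hPc_low := hlow (C₀' * 2 ^ k * (k + 1)) (2 ^ k) _ hs2 h2k hsL hε_pos hεL
    have hmax : max 0 ((pcI : ℝ) - Pc (C₀' * 2 ^ k * (k + 1))) ≤ (C₁' / (2 : ℝ) ^ k) ^ e :=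
      max_le hε_pos.le (by linarith)
    have hcast : ((C₀' * 2 ^ k * (k + 1) : ℕ) : ℝ) = ((C₀' : ℝ) * ((k : ℝ) + 1)) * (2 : ℝ) ^ k := by
      push_cast; ring
    have hB1 : (1 : ℝ) ≤ (C₀' : ℝ) * ((k : ℝ) + 1) := by
      have h1' : (1 : ℝ) ≤ C₀' := by exact_mod_cast hC₀'1
      have h2' : (1 : ℝ) ≤ (k : ℝ) + 1 := by linarith [(Nat.cast_nonneg k : (0 : ℝ) ≤ k)]
      nlinarith
    have hB0 : (0 : ℝ) ≤ (C₀' : ℝ) * ((k : ℝ) + 1) := by linarith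
    have hBpow : ((C₀' : ℝ) * ((k : ℝ) + 1)) ^ ((5 : ℝ) / 6) ≤ (C₀' : ℝ) * ((k : ℝ) + 1) := by
      calc ((C₀' : ℝ) * ((k : ℝ) + 1)) ^ ((5 : ℝ) / 6) ≤ ((C₀' : ℝ) * ((k : ℝ) + 1)) ^ (1 : ℝ) :=
            Real.rpow_le_rpow_of_exponent_le hB1 (by norm_num)
        _ = (C₀' : ℝ) * ((k : ℝ) + 1) := Real.rpow_one _
    have hapow : ((2 : ℝ) ^ k) ^ ((5 : ℝ) / 6 - e) = r ^ k := by
      rw [hr_def, ← Real.rpow_natCast 2 k, ← Real.rpow_mul (by norm_num : (0 : ℝ) ≤ 2), mul_comm,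
        Real.rpow_mul (by norm_num : (0 : ℝ) ≤ 2), Real.rpow_natCast]
    have hae : ((2 : ℝ) ^ k) ^ ((5 : ℝ) / 6) / ((2 : ℝ) ^ k) ^ e = r ^ k := by
      rw [← Real.rpow_sub ha_pos, hapow]
    calc θc ≤ Θ (C₀' * 2 ^ k * (k + 1)) pcI := hcmp _ hs2
      _ ≤ C' * ((C₀' * 2 ^ k * (k + 1) : ℕ) : ℝ) ^ ((5 : ℝ) / 6) * max 0 ((pcI : ℝ) - Pc (C₀' * 2 ^ k * (k + 1))) :=
          hS' _ hs2
      _ ≤ C' * ((C₀' * 2 ^ k * (k + 1) : ℕ) : ℝ) ^ ((5 : ℝ) / 6) * (C₁' / (2 : ℝ) ^ k) ^ e :=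
          mul_le_mul_of_nonneg_left hmax (mul_nonneg hC'pos.le (Real.rpow_nonneg (Nat.cast_nonneg _) _))
      _ = C' * ((((C₀' : ℝ) * ((k : ℝ) + 1)) ^ ((5 : ℝ) / 6)) * ((2 : ℝ) ^ k) ^ ((5 : ℝ) / 6)) * (C₁' ^ e / ((2 : ℝ) ^ k) ^ e) := by
          rw [hcast, Real.mul_rpow hB0 ha_pos.le, Real.div_rpow hC₁'pos.le ha_pos.le]
      _ ≤ C' * (((C₀' : ℝ) * ((k : ℝ) + 1)) * ((2 : ℝ) ^ k) ^ ((5 : ℝ) / 6)) * (C₁' ^ e / ((2 : ℝ) ^ k) ^ e) := by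
          apply mul_le_mul_of_nonneg_right
          · apply mul_le_mul_of_nonneg_left _ hC'pos.le
            exact mul_le_mul_of_nonneg_right hBpow (Real.rpow_nonneg ha_pos.le _)
          · exact div_nonneg (Real.rpow_nonneg hC₁'pos.le _) (Real.rpow_nonneg ha_pos.le _)
      _ = C' * (C₀' : ℝ) * C₁' ^ e * ((k : ℝ) + 1) * (((2 : ℝ) ^ k) ^ ((5 : ℝ) / 6) / ((2 : ℝ) ^ k) ^ e) := by
          ring
      _ = C' * (C₀' : ℝ) * C₁' ^ e * ((k : ℝ) + 1) * r ^ k := by rw [hae]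
      _ = C' * C₀' * C₁' ^ e / r * (((k : ℝ) + 1) * r ^ (k + 1)) := by
          rw [div_mul_eq_mul_div, eq_div_iff hrne]
          ring
      _ ≤ δ := hk'.le
  show Literature.Probability.Percolation.theta (Literature.Probability.LatticeModels.zdGraph 3)
      (0 : Literature.Probability.LatticeModels.Site 3) (Literature.Probability.Percolation.criticalProbI 3) = 0
  refine le_antisymm ?_ MeasureTheory.measureReal_nonneg
  -- Θ s p := θ_{G_s}(õ, p), Pc s := p_c(G_s, õ), crit := the finite-size criterion (all read off the items by unification)
  refine key _ _ _ (Literature.Probability.Percolation.criticalProbI 3) _ ?_ ?_ hTransfer hLen hSlope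
  · -- covering monotonicity along Prod.fst : G_s → ℤ³ (a covering map by CoverIsCoveringR), õ ↦ 0
    intro s hs
    exact hMono _ (Literature.Probability.LatticeModels.zdGraph 3) Prod.fst (fun v => (hCov s hs v).surjOn)
      ((0 : Literature.Probability.LatticeModels.Site 3), ([] : List (ℤ × ℤ × ℤ))) _
  · -- p_c(G_s, õ) = sInf ({q | θ_{G_s}(õ, q) > 0} ∪ {1}): a lower bound of that set is ≤ p_c
    intro s x hx1 hx
    refine le_csInf ⟨1, Or.inr rfl⟩ ?_
    rintro q (⟨hq01, hθ⟩ | hq1)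
    · exact hx ⟨q, hq01⟩ hθ
    · rw [Set.mem_singleton_iff] at hq1
      rw [hq1]
      exact hx1

end Summit.CriticalPhenomena.PercolationContinuityZ3.Theses.PercLoopDislocationCovers
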